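import Summits.CriticalPhenomena.PercolationContinuityZ3.Theorems.Transplant.CubicLatticesPlanarSkeleton
import Summits.CriticalPhenomena.PercolationContinuityZ3.Theorems.Transplant.PlanarSkeletonConcDefs
import HarnessLib

/-!
# The fcc lattice carries the design-(D) interface `PlanarSkeletonConc` (degree bound, outward steps, connected cylinders), hence
# `θ_{fcc}(p_c(fcc)) = 0` follows from the ONE node of record `SamePDropOfSkeletonConcLt` of the lane's general skeleton programme

builds on p205010 (kernel theorem, internal audit signed; external expert review pending) — nothing in this file uses p205010 (the near-one
gluing enters the node's intended PROOF; here only the fcc instance of its hypotheses is built).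
Status sentence (coordinator 2026-08-20T04:30Z): "θ(p_c) = 0 on ℤ^d, all d ≥ 2 — kernel-verified (Lean 4/Mathlib, standard axioms); internal
adversarial audit SIGNED 2026-08-20 04:29Z; external expert review pending."
Lane `prim-bschramm-*`, seat `prim-bschramm-p2` (gen 5; class C1b row F = 3D lattices other than `ℤ³` at their own critical points, METHOD = input
substitution: the ONE external input for fcc is the lane's general node, no published theorem); helper file (`--supports stmt-CriticalPhenomena-4575`).

p4's `fccSkeleton : PlanarSkeleton fccGraph` (`CubicLatticesPlanarSkeleton`: `φ = (x₀, x₁)`, frames = translations of `D₃`, point group = lifted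
`D₄`; `φ` is ℓ^∞-1-Lipschitz along the twelve minimal vectors `±e_i ± e_j` — the diagonal planar moves are admitted by the node of record, whose
planar cells are the NARROW ones of SHEAR-SCOPE (A2)) is upgraded to a `PlanarSkeletonConc`:
* (μ) `fcc_degree_le : degree ≤ 27` (`degree ≤ |B(v,1)| ≤ 3³`, `degree_le_ballVolume_one` + p4's `fcc_ballVolume_le`);
* (ι) `fcc_step`: `x ↦ x + σ e_i + e₂ ∈ D₃` moves `φ` by `σ e_i`;
* (κ) **`fccCyl_connected`**: for `ℓ ≥ 1` the induced graph on the cylinder `φ⁻¹(Λ_ℓ) = {|x₀|, |x₁| ≤ ℓ}` is connected — every cylinder vertex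
  descends to the origin inside the cylinder along minimal vectors, strictly decreasing `|x₀| + |x₁| + |x₂|` (two-step detours `(0,0,c) →
  (1,0,c∓1) → (0,0,c∓2)` and `(a,0,0) → (a∓1,1,0) → (a∓2,0,0)` on the axes, which is where `ℓ ≥ 1` is used; at `ℓ = 0` the cylinder
  `{(0,0,2k)}` is edgeless);
* `fccSkeletonConc : PlanarSkeletonConc fccGraph`;
* **`fccOwnCriticalContinuity_of_skeletonConcNode : SamePDropOfSkeletonConcLt → FccOwnCriticalContinuity`** (`continuity_of_skeletonConcLt_drop_amenable`:
  fcc is connected, `Aut`-transitive, amenable (uniqueness by the tree's Burton–Keane), `p_c(fcc) < 1`, cylinders subcritical at `p_c`).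
Nothing is claimed about the node; with `samePDropOfSkeletonConcLt_holds` (the lane's (Z')) the conclusion becomes unconditional — not in print.
[cite: BenjaminiSchramm1996, Conj. 4] [cite: KozmaNitzan2024, §1 p. 2 (approach 1); §4 p. 15] [cite: ConwaySloane1999, Ch. 4 §7.1 (D₃ and its minimal vectors)]
-/

noncomputable section

namespace Summit.CriticalPhenomena.PercolationContinuityZ3.Theorems.Transplant

open MeasureTheory Literature.Probability.Percolation Literature.Probability.LatticeModels SimpleGraph
open Literature.Barriers.CriticalPhenomena (IsQuasiTransitive IsGraphAmenable graphBall graphBall_finite ballVolume)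

/-! ## (μ) the degree bound -/

/-- In a locally finite graph the degree of `v` is at most the volume of the ball `B(v, 1)`. [folklore] -/
theorem degree_le_ballVolume_one {V : Type*} (G : SimpleGraph V) [G.LocallyFinite] (v : V) : G.degree v ≤ ballVolume G v 1 := by
  rw [← SimpleGraph.card_neighborFinset_eq_degree, ballVolume, ← Set.ncard_coe_finset]
  refine Set.ncard_le_ncard (fun y hy => ?_) (graphBall_finite G v 1)
  rw [Finset.mem_coe, SimpleGraph.mem_neighborFinset] at hy
  exact ⟨SimpleGraph.Walk.cons hy SimpleGraph.Walk.nil, le_rfl⟩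

/-- **(μ) for fcc**: every vertex has degree `≤ 27` (indeed `12`; `|B(v,1)| ≤ 3³` suffices). [cite: ConwaySloane1999, Ch. 4 §7.1] -/
theorem fcc_degree_le (v : fccSite) : fccGraph.degree v ≤ 27 :=
  (degree_le_ballVolume_one fccGraph v).trans ((fcc_ballVolume_le v 1).trans (by norm_num))

/-! ## Translates by minimal vectors -/

/-- The translate `x + (a, b, c)` of an fcc site by a vector of even coordinate sum, as an fcc site. [folklore] -/
def fccShift (x : fccSite) (a b c : ℤ) (h : Even (a + b + c)) : fccSite :=
  ⟨(x : Site 3) + ![a, b, c], by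
    rw [mem_fccSite_iff]
    obtain ⟨k, hk⟩ := (mem_fccSite_iff _).1 x.2
    obtain ⟨m, hm⟩ := h
    refine ⟨k + m, ?_⟩
    simp only [Pi.add_apply, Matrix.cons_val_zero, Matrix.cons_val_one, Matrix.cons_val_two, Matrix.head_cons, Matrix.tail_cons]
    omega⟩

/-- Coordinates of a translate. [folklore] -/
theorem fccShift_apply (x : fccSite) (a b c : ℤ) (h : Even (a + b + c)) :
    ((fccShift x a b c h : fccSite) : Site 3) 0 = (x : Site 3) 0 + a ∧ ((fccShift x a b c h : fccSite) : Site 3) 1 = (x : Site 3) 1 + b ∧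
      ((fccShift x a b c h : fccSite) : Site 3) 2 = (x : Site 3) 2 + c :=
  ⟨rfl, rfl, rfl⟩

/-- **Translating by a minimal vector (`a² + b² + c² = 2`) is an fcc edge.** [cite: ConwaySloane1999, Ch. 4 §7.1] -/
theorem fcc_adj_fccShift (x : fccSite) (a b c : ℤ) (h : Even (a + b + c)) (hsq : a ^ 2 + b ^ 2 + c ^ 2 = 2) :
    fccGraph.Adj x (fccShift x a b c h) := by
  obtain ⟨h0, h1, h2⟩ := fccShift_apply x a b c h
  rw [fccGraph_adj]
  refine ⟨fun heq => ?_, ?_⟩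
  · have e0 := congrFun heq 0
    have e1 := congrFun heq 1
    have e2 := congrFun heq 2
    rw [h0] at e0; rw [h1] at e1; rw [h2] at e2
    have ha : a = 0 := by linarith
    have hb : b = 0 := by linarith
    have hc : c = 0 := by linarith
    rw [ha, hb, hc] at hsq
    norm_num at hsq
  · rw [Fin.sum_univ_three, h0, h1, h2]
    have : ((x : Site 3) 0 - ((x : Site 3) 0 + a)) ^ 2 + ((x : Site 3) 1 - ((x : Site 3) 1 + b)) ^ 2 + ((x : Site 3) 2 - ((x : Site 3) 2 + c)) ^ 2 =
        a ^ 2 + b ^ 2 + c ^ 2 := by ring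
    rw [this, hsq]

/-! ## (ι) outward steps -/

/-- **(ι) for fcc**: at every vertex and for every planar axis `i` and sign `σ`, the minimal vector `σ e_i + e₂` is an edge moving the skeleton
coordinate by `σ e_i`. [cite: ConwaySloane1999, Ch. 4 §7.1] -/
theorem fcc_step (v : fccSite) (i : Fin 2) (σ : ℤˣ) : ∃ v' : fccSite, fccGraph.Adj v v' ∧ fccSkel v' = fccSkel v + Pi.single i (σ : ℤ) := by
  have hσ : (σ : ℤ) ^ 2 = 1 := by rcases Int.units_eq_one_or σ with h | h <;> simp [h]
  have hσe : Even ((σ : ℤ) + 1) := by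
    rcases Int.units_eq_one_or σ with h | h
    · rw [h]; exact ⟨1, by norm_num⟩
    · rw [h]; exact ⟨0, by norm_num⟩
  fin_cases i
  · have he : Even ((σ : ℤ) + 0 + 1) := by rw [add_zero]; exact hσe
    obtain ⟨h0, h1, -⟩ := fccShift_apply v (σ : ℤ) 0 1 he
    refine ⟨fccShift v (σ : ℤ) 0 1 he, fcc_adj_fccShift v _ _ _ he (by rw [hσ]; norm_num), ?_⟩
    ext j
    fin_cases j
    · show ((fccShift v (σ : ℤ) 0 1 he : fccSite) : Site 3) 0 = (v : Site 3) 0 + (Pi.single (0 : Fin 2) (σ : ℤ) : Site 2) 0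
      rw [h0]; simp
    · show ((fccShift v (σ : ℤ) 0 1 he : fccSite) : Site 3) 1 = (v : Site 3) 1 + (Pi.single (0 : Fin 2) (σ : ℤ) : Site 2) 1
      rw [h1]; simp
  · have he : Even (0 + (σ : ℤ) + 1) := by rw [zero_add]; exact hσe
    obtain ⟨h0, h1, -⟩ := fccShift_apply v 0 (σ : ℤ) 1 he
    refine ⟨fccShift v 0 (σ : ℤ) 1 he, fcc_adj_fccShift v _ _ _ he (by rw [hσ]; norm_num), ?_⟩
    ext j
    fin_cases j
    · show ((fccShift v 0 (σ : ℤ) 1 he : fccSite) : Site 3) 0 = (v : Site 3) 0 + (Pi.single (1 : Fin 2) (σ : ℤ) : Site 2) 0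
      rw [h0]; simp
    · show ((fccShift v 0 (σ : ℤ) 1 he : fccSite) : Site 3) 1 = (v : Site 3) 1 + (Pi.single (1 : Fin 2) (σ : ℤ) : Site 2) 1
      rw [h1]; simp

/-! ## (κ) the cylinders are connected -/

/-- The descent potential `|x₀| + |x₁| + |x₂|`. [folklore] -/
def fccPot (x : fccSite) : ℕ := ((x : Site 3) 0).natAbs + ((x : Site 3) 1).natAbs + ((x : Site 3) 2).natAbs

/-- Membership in the cylinder in linear form. [folklore] -/
theorem mem_fccCyl_iff' {ℓ : ℕ} {x : fccSite} :
    x ∈ fccCyl ℓ ↔ (-(ℓ : ℤ) ≤ (x : Site 3) 0 ∧ (x : Site 3) 0 ≤ ℓ) ∧ (-(ℓ : ℤ) ≤ (x : Site 3) 1 ∧ (x : Site 3) 1 ≤ ℓ) := by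
  rw [mem_fccCyl_iff, abs_le, abs_le]

/-- **One minimal-vector step inside the cylinder**, packaged: if `x + (a,b,c)` stays in the cylinder and lowers the potential, it is reachable in
the cylinder graph with smaller potential. [folklore] -/
theorem fccCyl_step₁ {ℓ : ℕ} {x : fccSite} (hx : x ∈ fccCyl ℓ) (a b c : ℤ) (h : Even (a + b + c)) (hsq : a ^ 2 + b ^ 2 + c ^ 2 = 2)
    (hm : (-(ℓ : ℤ) ≤ (x : Site 3) 0 + a ∧ (x : Site 3) 0 + a ≤ ℓ) ∧ (-(ℓ : ℤ) ≤ (x : Site 3) 1 + b ∧ (x : Site 3) 1 + b ≤ ℓ))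
    (hμ : ((x : Site 3) 0 + a).natAbs + ((x : Site 3) 1 + b).natAbs + ((x : Site 3) 2 + c).natAbs <
      ((x : Site 3) 0).natAbs + ((x : Site 3) 1).natAbs + ((x : Site 3) 2).natAbs) :
    ∃ (y : fccSite) (hy : y ∈ fccCyl ℓ), (fccCylGraph ℓ).Reachable ⟨x, hx⟩ ⟨y, hy⟩ ∧ fccPot y < fccPot x := by
  obtain ⟨h0, h1, h2⟩ := fccShift_apply x a b c h
  have hy : fccShift x a b c h ∈ fccCyl ℓ := by rw [mem_fccCyl_iff', h0, h1]; exact hm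
  refine ⟨fccShift x a b c h, hy, SimpleGraph.Adj.reachable ?_, ?_⟩
  · exact fcc_adj_fccShift x a b c h hsq
  · unfold fccPot; rw [h0, h1, h2]; exact hμ

/-- **Two minimal-vector steps inside the cylinder**, packaged (the detours on the axes). [folklore] -/
theorem fccCyl_step₂ {ℓ : ℕ} {x : fccSite} (hx : x ∈ fccCyl ℓ) (a b c : ℤ) (h : Even (a + b + c)) (hsq : a ^ 2 + b ^ 2 + c ^ 2 = 2)
    (hm : (-(ℓ : ℤ) ≤ (x : Site 3) 0 + a ∧ (x : Site 3) 0 + a ≤ ℓ) ∧ (-(ℓ : ℤ) ≤ (x : Site 3) 1 + b ∧ (x : Site 3) 1 + b ≤ ℓ))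
    (a' b' c' : ℤ) (h' : Even (a' + b' + c')) (hsq' : a' ^ 2 + b' ^ 2 + c' ^ 2 = 2)
    (hm' : (-(ℓ : ℤ) ≤ (x : Site 3) 0 + a + a' ∧ (x : Site 3) 0 + a + a' ≤ ℓ) ∧ (-(ℓ : ℤ) ≤ (x : Site 3) 1 + b + b' ∧ (x : Site 3) 1 + b + b' ≤ ℓ))
    (hμ : ((x : Site 3) 0 + a + a').natAbs + ((x : Site 3) 1 + b + b').natAbs + ((x : Site 3) 2 + c + c').natAbs <
      ((x : Site 3) 0).natAbs + ((x : Site 3) 1).natAbs + ((x : Site 3) 2).natAbs) :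
    ∃ (y : fccSite) (hy : y ∈ fccCyl ℓ), (fccCylGraph ℓ).Reachable ⟨x, hx⟩ ⟨y, hy⟩ ∧ fccPot y < fccPot x := by
  obtain ⟨h0, h1, h2⟩ := fccShift_apply x a b c h
  have hy : fccShift x a b c h ∈ fccCyl ℓ := by rw [mem_fccCyl_iff', h0, h1]; exact hm
  obtain ⟨h0', h1', h2'⟩ := fccShift_apply (fccShift x a b c h) a' b' c' h'
  rw [h0] at h0'; rw [h1] at h1'; rw [h2] at h2'
  have hz : fccShift (fccShift x a b c h) a' b' c' h' ∈ fccCyl ℓ := by rw [mem_fccCyl_iff', h0', h1']; exact hm'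
  refine ⟨fccShift (fccShift x a b c h) a' b' c' h', hz,
    (SimpleGraph.Adj.reachable (G := fccCylGraph ℓ) (u := ⟨x, hx⟩) (v := ⟨fccShift x a b c h, hy⟩) ?_).trans
      (SimpleGraph.Adj.reachable (G := fccCylGraph ℓ) (u := ⟨fccShift x a b c h, hy⟩) (v := ⟨fccShift (fccShift x a b c h) a' b' c' h', hz⟩) ?_), ?_⟩
  · exact fcc_adj_fccShift x a b c h hsq
  · exact fcc_adj_fccShift (fccShift x a b c h) a' b' c' h' hsq'
  · unfold fccPot; rw [h0', h1', h2']; exact hμ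

/-- **Descent in the cylinder** (`ℓ ≥ 1`): every cylinder vertex other than the origin reaches, inside the cylinder graph, a cylinder vertex of
strictly smaller potential. [folklore] -/
theorem fccCyl_descent {ℓ : ℕ} (hℓ : 1 ≤ ℓ) (x : fccSite) (hx : x ∈ fccCyl ℓ) (h0 : (x : Site 3) ≠ 0) :
    ∃ (y : fccSite) (hy : y ∈ fccCyl ℓ), (fccCylGraph ℓ).Reachable ⟨x, hx⟩ ⟨y, hy⟩ ∧ fccPot y < fccPot x := by
  have hℓ' : (1 : ℤ) ≤ ℓ := by exact_mod_cast hℓ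
  obtain ⟨⟨ha1, ha2⟩, ⟨hb1, hb2⟩⟩ := mem_fccCyl_iff'.1 hx
  obtain ⟨k, hk⟩ := (mem_fccSite_iff _).1 x.2
  have hne : (x : Site 3) 0 ≠ 0 ∨ (x : Site 3) 1 ≠ 0 ∨ (x : Site 3) 2 ≠ 0 := by
    by_contra hall
    push Not at hall
    obtain ⟨e₀, e₁, e₂⟩ := hall
    apply h0
    funext i
    fin_cases i
    · exact e₀
    · exact e₁
    · exact e₂
  have e2 : Even (2 : ℤ) := ⟨1, rfl⟩
  have e0 : Even (0 : ℤ) := ⟨0, rfl⟩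
  have em2 : Even (-2 : ℤ) := ⟨-1, rfl⟩
  rcases lt_trichotomy ((x : Site 3) 2) 0 with hc0 | hc0 | hc0
  · -- `x₂ < 0`: move up in the fibre
    rcases lt_trichotomy ((x : Site 3) 0) 0 with ha0 | ha0 | ha0
    · exact fccCyl_step₁ hx 1 0 1 (by norm_num) (by norm_num) ⟨⟨by omega, by omega⟩, ⟨by omega, by omega⟩⟩ (by omega)
    · rcases lt_trichotomy ((x : Site 3) 1) 0 with hb0 | hb0 | hb0
      · exact fccCyl_step₁ hx 0 1 1 (by norm_num) (by norm_num) ⟨⟨by omega, by omega⟩, ⟨by omega, by omega⟩⟩ (by omega)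
      · -- on the fibre axis: `x₂` is even, `x₂ ≤ -2`; detour through `(1, 0, x₂ + 1)`
        exact fccCyl_step₂ hx 1 0 1 (by norm_num) (by norm_num) ⟨⟨by omega, by omega⟩, ⟨by omega, by omega⟩⟩
          (-1) 0 1 (by norm_num) (by norm_num) ⟨⟨by omega, by omega⟩, ⟨by omega, by omega⟩⟩ (by omega)
      · exact fccCyl_step₁ hx 0 (-1) 1 (by norm_num) (by norm_num) ⟨⟨by omega, by omega⟩, ⟨by omega, by omega⟩⟩ (by omega)
    · exact fccCyl_step₁ hx (-1) 0 1 (by norm_num) (by norm_num) ⟨⟨by omega, by omega⟩, ⟨by omega, by omega⟩⟩ (by omega)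
  · rcases lt_trichotomy ((x : Site 3) 0) 0 with ha0 | ha0 | ha0
    · rcases lt_trichotomy ((x : Site 3) 1) 0 with hb0 | hb0 | hb0
      · exact fccCyl_step₁ hx 1 1 0 (by norm_num) (by norm_num) ⟨⟨by omega, by omega⟩, ⟨by omega, by omega⟩⟩ (by omega)
      · -- on the `x₀`-axis: `x₀` is even, `x₀ ≤ -2`; detour through `(x₀ + 1, 1, 0)`
        exact fccCyl_step₂ hx 1 1 0 (by norm_num) (by norm_num) ⟨⟨by omega, by omega⟩, ⟨by omega, by omega⟩⟩
          1 (-1) 0 (by norm_num) (by norm_num) ⟨⟨by omega, by omega⟩, ⟨by omega, by omega⟩⟩ (by omega)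
      · exact fccCyl_step₁ hx 1 (-1) 0 (by norm_num) (by norm_num) ⟨⟨by omega, by omega⟩, ⟨by omega, by omega⟩⟩ (by omega)
    · rcases lt_trichotomy ((x : Site 3) 1) 0 with hb0 | hb0 | hb0
      · -- on the `x₁`-axis: `x₁` is even, `x₁ ≤ -2`; detour through `(1, x₁ + 1, 0)`
        exact fccCyl_step₂ hx 1 1 0 (by norm_num) (by norm_num) ⟨⟨by omega, by omega⟩, ⟨by omega, by omega⟩⟩
          (-1) 1 0 (by norm_num) (by norm_num) ⟨⟨by omega, by omega⟩, ⟨by omega, by omega⟩⟩ (by omega)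
      · exact absurd hne (by push Not; exact ⟨ha0, hb0, hc0⟩)
      · exact fccCyl_step₂ hx 1 (-1) 0 (by norm_num) (by norm_num) ⟨⟨by omega, by omega⟩, ⟨by omega, by omega⟩⟩
          (-1) (-1) 0 (by norm_num) (by norm_num) ⟨⟨by omega, by omega⟩, ⟨by omega, by omega⟩⟩ (by omega)
    · rcases lt_trichotomy ((x : Site 3) 1) 0 with hb0 | hb0 | hb0
      · exact fccCyl_step₁ hx (-1) 1 0 (by norm_num) (by norm_num) ⟨⟨by omega, by omega⟩, ⟨by omega, by omega⟩⟩ (by omega)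
      · exact fccCyl_step₂ hx (-1) 1 0 (by norm_num) (by norm_num) ⟨⟨by omega, by omega⟩, ⟨by omega, by omega⟩⟩
          (-1) (-1) 0 (by norm_num) (by norm_num) ⟨⟨by omega, by omega⟩, ⟨by omega, by omega⟩⟩ (by omega)
      · exact fccCyl_step₁ hx (-1) (-1) 0 (by norm_num) (by norm_num) ⟨⟨by omega, by omega⟩, ⟨by omega, by omega⟩⟩ (by omega)
  · -- `x₂ > 0`: move down in the fibre
    rcases lt_trichotomy ((x : Site 3) 0) 0 with ha0 | ha0 | ha0
    · exact fccCyl_step₁ hx 1 0 (-1) (by norm_num) (by norm_num) ⟨⟨by omega, by omega⟩, ⟨by omega, by omega⟩⟩ (by omega)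
    · rcases lt_trichotomy ((x : Site 3) 1) 0 with hb0 | hb0 | hb0
      · exact fccCyl_step₁ hx 0 1 (-1) (by norm_num) (by norm_num) ⟨⟨by omega, by omega⟩, ⟨by omega, by omega⟩⟩ (by omega)
      · exact fccCyl_step₂ hx 1 0 (-1) (by norm_num) (by norm_num) ⟨⟨by omega, by omega⟩, ⟨by omega, by omega⟩⟩
          (-1) 0 (-1) (by norm_num) (by norm_num) ⟨⟨by omega, by omega⟩, ⟨by omega, by omega⟩⟩ (by omega)
      · exact fccCyl_step₁ hx 0 (-1) (-1) (by norm_num) (by norm_num) ⟨⟨by omega, by omega⟩, ⟨by omega, by omega⟩⟩ (by omega)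
    · exact fccCyl_step₁ hx (-1) 0 (-1) (by norm_num) (by norm_num) ⟨⟨by omega, by omega⟩, ⟨by omega, by omega⟩⟩ (by omega)

/-- **Every cylinder vertex reaches the origin inside the cylinder** (`ℓ ≥ 1`), by induction on the potential. [folklore] -/
theorem fccCyl_reachable_origin {ℓ : ℕ} (hℓ : 1 ≤ ℓ) :
    ∀ (n : ℕ) (x : fccSite) (hx : x ∈ fccCyl ℓ), fccPot x ≤ n → (fccCylGraph ℓ).Reachable ⟨x, hx⟩ ⟨fccOrigin, fccOrigin_mem_fccCyl ℓ⟩ := by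
  intro n
  induction n with
  | zero =>
    intro x hx hn
    have hx0 : (x : Site 3) = 0 := by
      unfold fccPot at hn
      funext i
      fin_cases i
      · show (x : Site 3) 0 = 0; omega
      · show (x : Site 3) 1 = 0; omega
      · show (x : Site 3) 2 = 0; omega
    have : (⟨x, hx⟩ : fccCyl ℓ) = ⟨fccOrigin, fccOrigin_mem_fccCyl ℓ⟩ := Subtype.ext (Subtype.ext hx0)
    rw [this]
  | succ n ih =>
    intro x hx hn
    by_cases h0 : (x : Site 3) = 0
    · have : (⟨x, hx⟩ : fccCyl ℓ) = ⟨fccOrigin, fccOrigin_mem_fccCyl ℓ⟩ := Subtype.ext (Subtype.ext h0)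
      rw [this]
    · obtain ⟨y, hy, hreach, hμ⟩ := fccCyl_descent hℓ x hx h0
      exact hreach.trans (ih y hy (by omega))

/-- **(κ) for fcc: the cylinders `φ⁻¹(Λ_ℓ)`, `ℓ ≥ 1`, are connected.** [cite: KozmaNitzan2024, §4 p. 15] [cite: ConwaySloane1999, Ch. 4 §7.1] -/
theorem fccCyl_connected {ℓ : ℕ} (hℓ : 1 ≤ ℓ) : (fccCylGraph ℓ).Connected := by
  haveI : Nonempty (fccCyl ℓ) := ⟨⟨fccOrigin, fccOrigin_mem_fccCyl ℓ⟩⟩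
  refine SimpleGraph.Connected.mk fun u v => ?_
  have hu := fccCyl_reachable_origin hℓ (fccPot (u : fccSite)) (u : fccSite) u.2 le_rfl
  have hv := fccCyl_reachable_origin hℓ (fccPot (v : fccSite)) (v : fccSite) v.2 le_rfl
  exact hu.trans hv.symm

/-! ## The interface and the conditional continuity -/

/-- **The fcc lattice carries the design-(D) interface `PlanarSkeletonConc`**: p4's `fccSkeleton` + degree `≤ 27` + outward steps + connected
cylinders (`ℓ ≥ 1`). [cite: KozmaNitzan2024, §4 p. 15] [cite: ConwaySloane1999, Ch. 4 §7.1] -/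
def fccSkeletonConc : PlanarSkeletonConc fccGraph where
  toPlanarSkeleton := fccSkeleton
  Δ := 27
  degree_le := fcc_degree_le
  step := fcc_step
  cyl_connected := by
    intro t ht ℓ hℓ
    rw [fccSkeleton_types, Finset.mem_singleton] at ht
    subst ht
    have e : {w : fccSite | fccSkeleton.φ w - fccSkeleton.φ fccOrigin ∈ box 2 ℓ} = fccCyl ℓ := cyl_fccSkeleton ℓ
    rw [e]
    exact fccCyl_connected hℓ

/-- The underlying planar skeleton is `fccSkeleton`. [folklore] -/
@[simp] theorem fccSkeletonConc_toPlanarSkeleton : fccSkeletonConc.toPlanarSkeleton = fccSkeleton := rfl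

/-- **`θ_{fcc}(p_c(fcc)) = 0` from the node of record `SamePDropOfSkeletonConcLt`** (never asserted): fcc is connected, `Aut`-transitive (hence
quasi-transitive), amenable (uniqueness by the tree's Burton–Keane), `p_c(fcc) < 1`, interface `fccSkeletonConc`, cylinders subcritical at `p_c`.
Conditional on the node alone; with the lane's (Z') it becomes unconditional — builds on p205010 (kernel theorem, internal audit signed; external
expert review pending) only inside the node's proof. [cite: BenjaminiSchramm1996, Conj. 4] [cite: KozmaNitzan2024, §1 p. 2 (approach 1)] -/
theorem fccOwnCriticalContinuity_of_skeletonConcNode (hD : SamePDropOfSkeletonConcLt) : FccOwnCriticalContinuity := by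
  unfold FccOwnCriticalContinuity
  refine continuity_of_skeletonConcLt_drop_amenable hD fccGraph fccSkeletonConc fccGraph_connected
    (isQuasiTransitive_of_isPretransitive fccGraph fccOrigin isPretransitive_aut_fcc) fcc_isGraphAmenable fccOrigin
    (Finset.mem_singleton_self _) criticalProb_fcc_lt_one ?_
  rw [fccSkeletonConc_toPlanarSkeleton]
  exact fccSkeleton_cylSubcritical_criticalProb

/-- The same from the binder-less node `SamePDropOfSkeletonConc`. [folklore] -/
theorem fccOwnCriticalContinuity_of_skeletonConcNode_of_conc (hD : SamePDropOfSkeletonConc) : FccOwnCriticalContinuity :=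
  fccOwnCriticalContinuity_of_skeletonConcNode (samePDropOfSkeletonConcLt_of_conc hD)

/-- … at EVERY vertex of the fcc lattice (vertex-transitivity: the translation `x ↦ x + v` is an automorphism carrying the origin to `v`;
`theta_iso`, `criticalProb_iso`). [cite: BenjaminiSchramm1996, Conj. 4] -/
theorem fcc_criticalContinuity_of_skeletonConcNode (hD : SamePDropOfSkeletonConcLt) (v : fccSite) :
    theta fccGraph v (criticalProbIOf fccGraph v) = 0 := by
  haveI : Countable fccSite := inferInstance
  have hθ := theta_iso (distSqGraphShiftIso 3 2 fccSubgroup v) fccOrigin (criticalProbIOf fccGraph fccOrigin)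
  have hpc := criticalProb_iso (distSqGraphShiftIso 3 2 fccSubgroup v) fccOrigin
  rw [distSqGraphShiftIso_fccOrigin] at hθ hpc
  have e : criticalProbIOf fccGraph v = criticalProbIOf fccGraph fccOrigin := Subtype.ext hpc
  have h0 : theta fccGraph fccOrigin (criticalProbIOf fccGraph fccOrigin) = 0 := fccOwnCriticalContinuity_of_skeletonConcNode hD
  rw [e]
  exact hθ.trans h0

end Summit.CriticalPhenomena.PercolationContinuityZ3.Theorems.Transplant

end
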